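import Summits.QuantumFields.BalabanUV.T4Continuum.Spine.NE1p.B7AveragingLogProductCommutator
import Summits.QuantumFields.BalabanUV.T4Continuum.Spine.NE1p.B7AveragingAbelianSector
import Literature.MathematicalPhysics.QuantumFieldTheory.Balaban1983to89.B8Ineq130

/-!
# T⁴ programme, spine estimate NE1′ (node O3b/H2) — DOOR (d) ON THE PRINTED WORDS: the second-order term of Bałaban's
# `log U(Γ)` (21)∕(9) at `U = e^{tA}` along ANY lattice word `Γ` obeys the WORD RECURSION
# `κ(b :: Γ) = κ(Γ) + [A(b), A(Γ)]`, `κ(∅) = 0` — i.e. it is the ordered sum of the pairwise commutators of the signed bond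
# exponents, in the b07 lineage's own vocabulary (`hol`, `stepA`, `asum`)

Cell `pub-balaban-gaps` (YM blitz Y1, track G2), seat `ne1` gen 9 (prover-pub-balaban-gaps-ne1-g9-0); record `HOME/ne/NE1.md` v9 §4 R56∕R57.
ADDITIVE — imports this seat's `B7AveragingLogProductCommutator` (gen 9: the composition law `iteratedDeriv_two_mlog_mul`,
`iteratedDeriv_two_mlog_exp_smul_zero`) and `B7AveragingAbelianSector` (gen 8: `val_stepHol_expCfg`, one letter of (9) at `e^{A}` is
`exp(±A_b)`), and the lineages' `B8Ineq130` (`hol_one`) ∕ `B7Prop1Explicit` (`hol`, `stepHol`, `stepA`, `asum` — (9) and the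
abelian path functional) ∕ `B7Prop3Flat` (`expCfg` (109), `stepA_csmul`) BY NAME; nothing edited or restated; 0 def.

PRINT.  [Balaban1985Averaging] (9) p. 18 `U(Γ) = U(b₁)⋯U(b_n)`, `U(−b) = U(b)⁻¹`; (21) p. 21 the logarithm; (15) p. 19 ∕ (42) p. 23 the
average `exp[L^{−d}Σ_x log(U(Γ_{c,x})U(c)⁻¹)]·U(c)`; p. 20 «expanding the logarithm … in powers of A, we get the expression (14) as a
linear term».  This file computes the QUADRATIC term of `log U(Γ)` at `U = e^{tA}` for every word `Γ`.

WHAT THIS FILE PROVES ([folklore] over the lineage's verbatim `ℤᵈ` model; 0 sorry):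
* `val_stepHol_expCfg_smul` — one letter of `e^{tA}` is the one-parameter group `exp(t·(±A_b))` (`stepA` carries the sign);
* `val_hol_expCfg_smul_cons` — `e^{tA}(b :: Γ) = exp(t·stepA) · e^{tA}(Γ)` (from the advanced base point);
* `exists_derivData_hol_expCfg` — derivative data of `t ↦ e^{tA}(Γ)`: a derivative at every `t`, differentiable again at `0`,
  velocity `A(Γ)` (`asum`) at `0`;
* **`iteratedDeriv_two_mlog_hol_expCfg_nil` ∕ `_cons` — THE WORD RECURSION**: with `κ(Γ) := d²/dt²|₀ log e^{tA}(Γ)`,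
  `κ(∅) = 0` and `κ(b :: Γ) = κ(Γ) + [stepA(b), A(Γ)]` — the composition law with the one-parameter first letter; unfolding it,
  `κ(Γ) = Σ_{i<j} [±A_{b_i}, ±A_{b_j}]` over the ordered letters of `Γ`: «cross-bond curvature = commutators» for the PRINTED
  transport∕logarithm along Bałaban's OWN words (the loop words `Γ_{c,x} ∪ (−c)` of (15) included), general non-commuting field.
* **`iteratedDeriv_two_mlog_bavg_expCfg` — DOOR (d) FOR THE PRINTED AVERAGE (42)∕(15)**: for EVERY bond field `A`,
  `d²/dt²|₀ log Ū_c(e^{tA}) = Σ_x L^{−d} d²/dt²|₀ log e^{tA}(Γ_{c,x} ∪ (−Γ_c)) + d²/dt²|₀ log e^{tA}(Γ_c) + [X̂_c(A), A(Γ_c)]`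
  (gen 9's outer step `iteratedDeriv_two_mlog_exp_mul` on `Ū_c = exp[X_c]·U(Γ_c)` with the exponent's derivative data assembled
  termwise) — with the word recursion, EVERY TERM IS A COMMUTATOR of (signed, possibly averaged) bond exponents.
* `iteratedDeriv_two_mlog_hol_expCfg_of_commute` ∕ `iteratedDeriv_two_mlog_bavg_expCfg_of_commute` — consistency with gen 8's abelian
  sector, now with NO logarithm-radius hypothesis: all commutators vanish ⟹ `d²/dt²|₀ log Ū_c(e^{tA}) = 0`.
What it does NOT do: no estimate (the quantitative «∝ non-flatness» at a non-commuting background stays READING); the iterate (43).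

HONEST FRAMING.  [folklore] calculus; nothing of Bałaban's asserted beyond the SHAPE of (9)∕(21) as typed by the lineage; NE1′ NOT proved;
spine 0∕9; (B) 0∕13; binders 0∕6; one fixed finite T⁴ — NOT ℝ⁴, NOT infinite volume, NOT a mass gap, NOT Clay.
-/

noncomputable section

open scoped Topology
open NormedSpace Filter

namespace Summit.QuantumFields.BalabanUV.T4Continuum.NE1p.B7AveragingCommutator

open Literature.MathematicalPhysics.QuantumFieldTheory.Balaban1983to89.MatrixLog (mlog mlog_one)

open Literature.MathematicalPhysics.QuantumFieldTheory.Balaban1983to89.B7Prop1Explicit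
open Literature.MathematicalPhysics.QuantumFieldTheory.Balaban1983to89.B7Prop3Flat (expCfg stepA_csmul)
open Literature.MathematicalPhysics.QuantumFieldTheory.Balaban1983to89.B7Prop3GeneralRotated (expCfg_zero)
open Literature.MathematicalPhysics.QuantumFieldTheory.Balaban1983to89.B8Ineq130 (hol_one)
open Summit.QuantumFields.BalabanUV.T4Continuum.NE1p.B7AveragingAbelianSector (val_stepHol_expCfg)

variable {d : ℕ} {𝔸 : Type*} [NormedRing 𝔸] [NormedAlgebra ℂ 𝔸] [CompleteSpace 𝔸]

/-! ## §1 One letter, one word: `e^{tA}` along Bałaban's words -/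

/-- ONE LETTER of `e^{tA}` is a one-parameter group: `e^{tA}(±b) = exp(t·(±A_b))` (gen 8's `val_stepHol_expCfg` and the lineage's
`stepA_csmul`). [cite: Balaban1985Averaging, (9) p.18, (109) p.34] -/
theorem val_stepHol_expCfg_smul (A : Site d → Fin d → 𝔸) (x : Site d) (l : Letter d) (t : ℂ) :
    ((stepHol (expCfg (t • A)) x l : 𝔸ˣ) : 𝔸) = exp (t • stepA A x l) := by
  rw [val_stepHol_expCfg, stepA_csmul]

/-- `e^{tA}(b :: Γ) = exp(t·stepA(b)) · e^{tA}(Γ)`, the tail read from the advanced base point — (9) one letter at a time.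
[cite: Balaban1985Averaging, (9) p.18] -/
theorem val_hol_expCfg_smul_cons (A : Site d → Fin d → 𝔸) (x : Site d) (l : Letter d) (w : List (Letter d)) (t : ℂ) :
    ((hol (expCfg (t • A)) x (l :: w) : 𝔸ˣ) : 𝔸)
      = exp (t • stepA A x l) * ((hol (expCfg (t • A)) (x + l.vec) w : 𝔸ˣ) : 𝔸) := by
  rw [hol_cons, Units.val_mul, val_stepHol_expCfg_smul]

/-- At `t = 0` the transport is `1`: `e^{0·A}(Γ) = 1`. [cite: Balaban1985Averaging, (9) p.18] -/
theorem val_hol_expCfg_zero_smul (A : Site d → Fin d → 𝔸) (x : Site d) (w : List (Letter d)) :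
    ((hol (expCfg ((0 : ℂ) • A)) x w : 𝔸ˣ) : 𝔸) = 1 := by
  rw [zero_smul, expCfg_zero, hol_one, Units.val_one]

/-- **Derivative data of the word transport** `t ↦ e^{tA}(Γ)` (word `Γ` spelled from `x`): a derivative `γ₁(t)` at every `t`,
`γ₁` differentiable at `0`, and `γ₁(0) = A(Γ)` — the LINEAR term of (9) in `A` is the abelian path functional (p. 24∕25,
the lineage's `walk_linear`), here with full derivative data for the second-order calculus. [cite: Balaban1985Averaging, (9) p.18, p.25] -/
theorem exists_derivData_hol_expCfg (A : Site d → Fin d → 𝔸) :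
    ∀ (w : List (Letter d)) (x : Site d), ∃ γ₁ : ℂ → 𝔸, ∃ w₂ : 𝔸,
      (∀ t : ℂ, HasDerivAt (fun u : ℂ => ((hol (expCfg (u • A)) x w : 𝔸ˣ) : 𝔸)) (γ₁ t) t)
        ∧ HasDerivAt γ₁ w₂ 0 ∧ γ₁ 0 = asum A x w
  | [], x => by
    refine ⟨fun _ => 0, 0, fun t => ?_, hasDerivAt_const (0 : ℂ) (0 : 𝔸), by simp⟩
    simpa using hasDerivAt_const t (1 : 𝔸)
  | l :: w, x => by
    obtain ⟨β₁, wb, hβ, hβ₁, hβ0⟩ := exists_derivData_hol_expCfg A w (x + l.vec)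
    refine ⟨fun t => stepA A x l * exp (t • stepA A x l) * ((hol (expCfg (t • A)) (x + l.vec) w : 𝔸ˣ) : 𝔸)
        + exp (t • stepA A x l) * β₁ t, ?_, fun t => ?_, ?_, ?_⟩
    · exact stepA A x l * stepA A x l * ((hol (expCfg ((0 : ℂ) • A)) (x + l.vec) w : 𝔸ˣ) : 𝔸)
        + stepA A x l * exp ((0 : ℂ) • stepA A x l) * β₁ 0
        + (stepA A x l * exp ((0 : ℂ) • stepA A x l) * β₁ 0 + exp ((0 : ℂ) • stepA A x l) * wb)
    · have h := (hasDerivAt_exp_smul_const' (stepA A x l) t).fun_mul (hβ t)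
      have e : (fun u : ℂ => ((hol (expCfg (u • A)) x (l :: w) : 𝔸ˣ) : 𝔸))
          = fun u : ℂ => exp (u • stepA A x l) * ((hol (expCfg (u • A)) (x + l.vec) w : 𝔸ˣ) : 𝔸) := by
        funext u; exact val_hol_expCfg_smul_cons A x l w u
      rw [e]
      simpa [mul_assoc] using h
    · have h1 : HasDerivAt (fun t : ℂ => stepA A x l * exp (t • stepA A x l) * ((hol (expCfg (t • A)) (x + l.vec) w : 𝔸ˣ) : 𝔸))
          (stepA A x l * stepA A x l * ((hol (expCfg ((0 : ℂ) • A)) (x + l.vec) w : 𝔸ˣ) : 𝔸)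
            + stepA A x l * exp ((0 : ℂ) • stepA A x l) * β₁ 0) 0 := by
        have := ((hasDerivAt_exp_smul_const' (stepA A x l) (0 : ℂ)).const_mul (stepA A x l)).fun_mul (hβ 0)
        simpa [mul_assoc] using this
      have h2 : HasDerivAt (fun t : ℂ => exp (t • stepA A x l) * β₁ t)
          (stepA A x l * exp ((0 : ℂ) • stepA A x l) * β₁ 0 + exp ((0 : ℂ) • stepA A x l) * wb) 0 :=
        (hasDerivAt_exp_smul_const' (stepA A x l) (0 : ℂ)).fun_mul hβ₁
      exact h1.fun_add h2
    · simp [hβ0, hol_one]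

/-! ## §2 The word recursion for the quadratic term of `log e^{tA}(Γ)` -/

/-- The empty word: `d²/dt²|₀ log e^{tA}(∅) = 0`. [cite: Balaban1985Averaging, (9) p.18, (21) p.21] -/
theorem iteratedDeriv_two_mlog_hol_expCfg_nil (A : Site d → Fin d → 𝔸) (x : Site d) :
    iteratedDeriv 2 (fun t : ℂ => mlog ((hol (expCfg (t • A)) x [] : 𝔸ˣ) : 𝔸)) 0 = 0 := by
  have e : (fun t : ℂ => mlog ((hol (expCfg (t • A)) x [] : 𝔸ˣ) : 𝔸)) = fun _ : ℂ => (0 : 𝔸) := by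
    funext t; simp
  rw [e, iteratedDeriv_eq_iterate]
  simp

/-- **THE WORD RECURSION**: `d²/dt²|₀ log e^{tA}(b :: Γ) = d²/dt²|₀ log e^{tA}(Γ) + [stepA(b), A(Γ)]` (the tail spelled from the
advanced base point) — gen 9's composition law `iteratedDeriv_two_mlog_mul` with the one-parameter first letter (no
`log`-curvature, velocity `stepA(b)`) and the word transport's derivative data (velocity `A(Γ)`).  Unfolded along the word:
`d²/dt²|₀ log e^{tA}(Γ) = Σ_{i<j} [±A_{b_i}, ±A_{b_j}]` (ordered letters, signs by orientation) — the QUADRATIC TERM of the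
printed logarithm of the printed transport is a sum of COMMUTATORS, for every word and every (non-commuting) field.
[cite: Balaban1985Averaging, (9) p.18, (21) p.21, p.20] -/
theorem iteratedDeriv_two_mlog_hol_expCfg_cons (A : Site d → Fin d → 𝔸) (x : Site d) (l : Letter d)
    (w : List (Letter d)) :
    iteratedDeriv 2 (fun t : ℂ => mlog ((hol (expCfg (t • A)) x (l :: w) : 𝔸ˣ) : 𝔸)) 0
      = iteratedDeriv 2 (fun t : ℂ => mlog ((hol (expCfg (t • A)) (x + l.vec) w : 𝔸ˣ) : 𝔸)) 0
        + (stepA A x l * asum A (x + l.vec) w - asum A (x + l.vec) w * stepA A x l) := by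
  obtain ⟨β₁, wb, hβ, hβ₁, hβ0⟩ := exists_derivData_hol_expCfg A w (x + l.vec)
  have e : (fun t : ℂ => mlog ((hol (expCfg (t • A)) x (l :: w) : 𝔸ˣ) : 𝔸))
      = fun t : ℂ => mlog (exp (t • stepA A x l) * ((hol (expCfg (t • A)) (x + l.vec) w : 𝔸ˣ) : 𝔸)) := by
    funext t; rw [val_hol_expCfg_smul_cons]
  have hα₁ : HasDerivAt (fun t : ℂ => stepA A x l * exp (t • stepA A x l)) (stepA A x l * stepA A x l) 0 := by
    simpa using (hasDerivAt_exp_smul_const' (stepA A x l) (0 : ℂ)).const_mul (stepA A x l)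
  rw [e, iteratedDeriv_two_mlog_mul (α := fun t : ℂ => exp (t • stepA A x l))
      (α₁ := fun t : ℂ => stepA A x l * exp (t • stepA A x l)) (by simp) (val_hol_expCfg_zero_smul A _ w)
      (Filter.Eventually.of_forall fun t => hasDerivAt_exp_smul_const' (stepA A x l) t)
      (Filter.Eventually.of_forall hβ) hα₁ hβ₁, iteratedDeriv_two_mlog_exp_smul_zero, hβ0]
  simp

/-- Two-letter word, closed form: `d²/dt²|₀ log e^{tA}(b₁ b₂) = [±A_{b₁}, ±A_{b₂}]`. [cite: Balaban1985Averaging, (9) p.18, (21) p.21] -/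
theorem iteratedDeriv_two_mlog_hol_expCfg_pair (A : Site d → Fin d → 𝔸) (x : Site d) (l₁ l₂ : Letter d) :
    iteratedDeriv 2 (fun t : ℂ => mlog ((hol (expCfg (t • A)) x [l₁, l₂] : 𝔸ˣ) : 𝔸)) 0
      = stepA A x l₁ * stepA A (x + l₁.vec) l₂ - stepA A (x + l₁.vec) l₂ * stepA A x l₁ := by
  rw [iteratedDeriv_two_mlog_hol_expCfg_cons, iteratedDeriv_two_mlog_hol_expCfg_cons,
    iteratedDeriv_two_mlog_hol_expCfg_nil]
  simp

/-! ## §3 The printed average (42)∕(15): `d²/dt²|₀ log Ū_c(e^{tA})` — every term a commutator -/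

section Average

variable (L : ℕ)

/-- `Ū_c(V)` IS `exp[X_c(V)] · V(Γ_c)` with `X_c(V) = Σ_x L^{−d} log(V(Γ_{c,x} ∪ (−Γ_c)))` — (42) unfolded on the lineage's
definitions (`bavg`, `Xavg`, `Wcx_eq_hol_loop`), at `V = e^{tA}`. [cite: Balaban1985Averaging, (42) p.23, (15) p.19] -/
theorem val_bavg_expCfg_smul_eq (A : Site d → Fin d → 𝔸) (q : Site d) (κ : Fin d) (t : ℂ) :
    ((bavg L (expCfg (t • A)) q κ : 𝔸ˣ) : 𝔸)
      = exp (∑ r : Fin d → Fin L, (((L : ℝ) ^ d)⁻¹) •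
            mlog ((hol (expCfg (t • A)) q (gammaWord L κ (boxVec L r) ++ seg κ (-(L : ℤ))) : 𝔸ˣ) : 𝔸))
        * ((hol (expCfg (t • A)) q (seg κ L) : 𝔸ˣ) : 𝔸) := by
  show (((expUnit (Xavg L (expCfg (t • A)) q κ) * hol (expCfg (t • A)) q (seg κ L) : 𝔸ˣ)) : 𝔸) = _
  rw [Units.val_mul, val_expUnit]
  unfold Xavg
  simp only [Wcx_eq_hol_loop]

/-- **DOOR (d) — THE CROSS-TERM FORMULA FOR THE PRINTED AVERAGE (42)∕(15)**: for every bond field `A` (no commutativity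
assumed) and every `L`-bond `c = ⟨q, q + Le_κ⟩`,
`d²/dt²|₀ log Ū_c(e^{tA}) = Σ_x L^{−d}·d²/dt²|₀ log e^{tA}(Γ_{c,x} ∪ (−Γ_c)) + d²/dt²|₀ log e^{tA}(Γ_c) + [X̂_c(A), A(Γ_c)]`,
where each `d²/dt²|₀ log e^{tA}(word)` is the ordered sum of pairwise commutators of the signed bond exponents (the word
recursion `iteratedDeriv_two_mlog_hol_expCfg_cons`) and `X̂_c(A) = Σ_x L^{−d} A(Γ_{c,x} ∪ (−Γ_c))` is the lineage's first-order
exponent (`Xhat`): EVERY TERM A COMMUTATOR — zero in every abelian sector (gen 8), and «cross-bond curvature = commutators»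
(NE1.md R46 (a)) for the PRINTED T-step with its contour system.  (Gen 9's outer step `iteratedDeriv_two_mlog_exp_mul` with the
exponent's derivative data assembled termwise from `derivData_mlog_comp` + `exists_derivData_hol_expCfg`.)
[cite: Balaban1985Averaging, (15) p.19, p.20, (42) p.23, (47) p.25] -/
theorem iteratedDeriv_two_mlog_bavg_expCfg (A : Site d → Fin d → 𝔸) (q : Site d) (κ : Fin d) :
    iteratedDeriv 2 (fun t : ℂ => mlog ((bavg L (expCfg (t • A)) q κ : 𝔸ˣ) : 𝔸)) 0
      = (∑ r : Fin d → Fin L, (((L : ℝ) ^ d)⁻¹) •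
            iteratedDeriv 2 (fun t : ℂ =>
              mlog ((hol (expCfg (t • A)) q (gammaWord L κ (boxVec L r) ++ seg κ (-(L : ℤ))) : 𝔸ˣ) : 𝔸)) 0)
        + iteratedDeriv 2 (fun t : ℂ => mlog ((hol (expCfg (t • A)) q (seg κ L) : 𝔸ˣ) : 𝔸)) 0
        + (Xhat L A q κ * asum A q (seg κ L) - asum A q (seg κ L) * Xhat L A q κ) := by
  -- derivative data of every loop logarithm (word recursion data + the composable chain rule)
  have hdata : ∀ r : Fin d → Fin L, ∃ F : ℂ → 𝔸, ∃ κ₂ : 𝔸,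
      (∀ᶠ t in 𝓝 (0 : ℂ), HasDerivAt (fun u : ℂ =>
          mlog ((hol (expCfg (u • A)) q (gammaWord L κ (boxVec L r) ++ seg κ (-(L : ℤ))) : 𝔸ˣ) : 𝔸)) (F t) t)
        ∧ HasDerivAt F κ₂ 0
        ∧ F 0 = asum A q (gammaWord L κ (boxVec L r) ++ seg κ (-(L : ℤ)))
        ∧ κ₂ = iteratedDeriv 2 (fun t : ℂ =>
              mlog ((hol (expCfg (t • A)) q (gammaWord L κ (boxVec L r) ++ seg κ (-(L : ℤ))) : 𝔸ˣ) : 𝔸)) 0 := by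
    intro r
    obtain ⟨γ₁, w₂, hγ, hγ₁, hγ0⟩ := exists_derivData_hol_expCfg A (gammaWord L κ (boxVec L r) ++ seg κ (-(L : ℤ))) q
    obtain ⟨hF, hF', hF0⟩ := derivData_mlog_comp (val_hol_expCfg_zero_smul A q _) (Filter.Eventually.of_forall hγ) hγ₁
    refine ⟨_, _, hF, hF', by rw [hF0, hγ0], ?_⟩
    rw [iteratedDeriv_two_mlog_comp (val_hol_expCfg_zero_smul A q _) (Filter.Eventually.of_forall hγ) hγ₁]
  choose F κ₂ hF hF' hF0 hκ₂ using hdata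
  -- the exponent `P(t) = X_c(e^{tA})` and its derivative data
  set c : ℝ := ((L : ℝ) ^ d)⁻¹ with hc
  have hP : ∀ᶠ t in 𝓝 (0 : ℂ), HasDerivAt (fun u : ℂ => ∑ r : Fin d → Fin L, c •
      mlog ((hol (expCfg (u • A)) q (gammaWord L κ (boxVec L r) ++ seg κ (-(L : ℤ))) : 𝔸ˣ) : 𝔸))
      (∑ r : Fin d → Fin L, c • F r t) t := by
    have hall : ∀ᶠ t in 𝓝 (0 : ℂ), ∀ r : Fin d → Fin L, HasDerivAt (fun u : ℂ =>
        mlog ((hol (expCfg (u • A)) q (gammaWord L κ (boxVec L r) ++ seg κ (-(L : ℤ))) : 𝔸ˣ) : 𝔸)) (F r t) t :=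
      Filter.eventually_all.2 hF
    filter_upwards [hall] with t ht
    exact HasDerivAt.fun_sum fun r _ => (ht r).const_smul c
  have hP₁ : HasDerivAt (fun t : ℂ => ∑ r : Fin d → Fin L, c • F r t) (∑ r : Fin d → Fin L, c • κ₂ r) 0 :=
    HasDerivAt.fun_sum fun r _ => (hF' r).const_smul c
  have hP0 : (∑ r : Fin d → Fin L, c •
      mlog ((hol (expCfg ((0 : ℂ) • A)) q (gammaWord L κ (boxVec L r) ++ seg κ (-(L : ℤ))) : 𝔸ˣ) : 𝔸)) = 0 := by
    simp [hol_one]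
  -- the straight word `Γ_c`
  obtain ⟨β₁, wb, hβ, hβ₁, hβ0⟩ := exists_derivData_hol_expCfg A (seg κ L) q
  -- assemble with the outer step
  have e : (fun t : ℂ => mlog ((bavg L (expCfg (t • A)) q κ : 𝔸ˣ) : 𝔸))
      = fun t : ℂ => mlog (exp (∑ r : Fin d → Fin L, c •
          mlog ((hol (expCfg (t • A)) q (gammaWord L κ (boxVec L r) ++ seg κ (-(L : ℤ))) : 𝔸ˣ) : 𝔸))
          * ((hol (expCfg (t • A)) q (seg κ L) : 𝔸ˣ) : 𝔸)) := by
    funext t; rw [val_bavg_expCfg_smul_eq]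
  rw [e, iteratedDeriv_two_mlog_exp_mul hP0 hP hP₁ (val_hol_expCfg_zero_smul A q _) (Filter.Eventually.of_forall hβ) hβ₁,
    hβ0]
  simp only [hF0, hκ₂]
  unfold Xhat
  rfl

end Average

/-! ## §4 Consistency with gen 8's abelian sector — now with NO radius hypothesis -/

/-- In an abelian sector every word has zero quadratic term: `d²/dt²|₀ log e^{tA}(Γ) = 0` when the values of `A` pairwise
commute (word recursion + gen 8's `commute_stepA_asum`). [cite: Balaban1985Averaging, (9) p.18, (21) p.21] -/
theorem iteratedDeriv_two_mlog_hol_expCfg_of_commute {A : Site d → Fin d → 𝔸}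
    (hA : ∀ x κ y μ, Commute (A x κ) (A y μ)) :
    ∀ (w : List (Letter d)) (x : Site d),
      iteratedDeriv 2 (fun t : ℂ => mlog ((hol (expCfg (t • A)) x w : 𝔸ˣ) : 𝔸)) 0 = 0
  | [], x => iteratedDeriv_two_mlog_hol_expCfg_nil A x
  | l :: w, x => by
    rw [iteratedDeriv_two_mlog_hol_expCfg_cons, iteratedDeriv_two_mlog_hol_expCfg_of_commute hA w (x + l.vec),
      (Summit.QuantumFields.BalabanUV.T4Continuum.NE1p.B7AveragingAbelianSector.commute_stepA_asum hA x l _ w).eq,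
      sub_self, add_zero]

/-- **Gen 8's «no diagonal curvature of the printed T-step» WITHOUT the logarithm-radius hypothesis**: if the values of
`A` pairwise commute then `d²/dt²|₀ log Ū_c(e^{tA}) = 0` for every `L`-bond — from the cross-term formula, every commutator
vanishing (gen 8's `iteratedDeriv_two_mlog_bavg_smul` needed the loop sums inside the radius of (21); the second
derivative AT `0` does not). [cite: Balaban1985Averaging, (15) p.19, (42) p.23] -/
theorem iteratedDeriv_two_mlog_bavg_expCfg_of_commute (L : ℕ) {A : Site d → Fin d → 𝔸}
    (hA : ∀ x κ y μ, Commute (A x κ) (A y μ)) (q : Site d) (κ : Fin d) :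
    iteratedDeriv 2 (fun t : ℂ => mlog ((bavg L (expCfg (t • A)) q κ : 𝔸ˣ) : 𝔸)) 0 = 0 := by
  rw [iteratedDeriv_two_mlog_bavg_expCfg,
    (Summit.QuantumFields.BalabanUV.T4Continuum.NE1p.B7AveragingAbelianSector.commute_Xhat_asum hA L q κ q _).eq,
    sub_self, add_zero, iteratedDeriv_two_mlog_hol_expCfg_of_commute hA, add_zero]
  exact Finset.sum_eq_zero fun r _ => by rw [iteratedDeriv_two_mlog_hol_expCfg_of_commute hA, smul_zero]

end Summit.QuantumFields.BalabanUV.T4Continuum.NE1p.B7AveragingCommutator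

end
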